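import Literature.NumberTheory.Kottwitz1992.InvolutionsLemma210Holds
import HarnessLib

/-!
# [Kottwitz1992, Lemma 2.11 p. 382] Two positive involutions differ by an inner automorphism — DISCHARGED:
# `Kottwitz1992_2_11_two_positive_involutions_holds`

Kernel-lane companion of the statement carpet ★ `Literature/NumberTheory/Kottwitz1992/Involutions.lean` (squad TK; builds on ★
`InvolutionsLemma210Holds`, Lemma 2.10): the named fact ★ `Involutions.Kottwitz1992_2_11_two_positive_involutions` — «Let `*`, `!` be two
positive involutions on `B`.  Then there exists `b ∈ B^×` such that `Int(b)` is a `*`-homomorphism from `(B, !)` to `(B, *)`.  Moreover we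
have `x^! = c⁻¹ x* c` for the element `c = b* b`» (typed with the last identity in the equivalent form `c x^! = x* c`) — is PROVED here as
`theorem Kottwitz1992_2_11_two_positive_involutions_holds : Kottwitz1992_2_11_two_positive_involutions B ι τ`.  THEOREMS ONLY (no
definition, no named fact, no `sorry`, no instance, no notation); cell hodgecm-mathlib, seat B-typ04 (g30); net debt −1.

R. E. Kottwitz, *Points on some Shimura varieties over finite fields*, J. Amer. Math. Soc. 5 (1992), Lemma 2.11 p. 382, proof p. 382
L36–L37 (held `paper:doi-10-2307-2152772`, p0010).  THE PRINTED PROOF: «Apply Lemma 2.10 to the identity map from `B` to `B` in order to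
get the first statement.  The second statement follows from the first.»  Followed verbatim: ★ `Kottwitz1992_2_10_starHom_conjugacy_holds`
(first statement) for the identity `(B, !) → (B, *)` — the standing hypothesis for `(B, !)` is that of `(B, *)` with the involution
identities of `!` — gives `b ∈ B^×` with `Int(b)` a `*`-homomorphism, `b x^! b⁻¹ = (b x b⁻¹)*`; expanding `(b x b⁻¹)* = (b⁻¹)* x* b*` and
multiplying by `b*` on the left and `b` on the right gives `(b* b) x^! = x* (b* b)`.
HONEST LABEL: HC_CM is proved only modulo the 7 printed citations (2 remaining: hLiu418, h413) until rung 0 closes; this file adds no citation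
debt (0 facts, 0 sorry) and discharges 1 named fact of ★ `Involutions`.

## References
* [Kottwitz1992] R. E. Kottwitz, Points on some Shimura varieties over finite fields, J. Amer. Math. Soc. 5 (1992) 373–444, Lemma 2.11 and
  its proof, p. 382; Lemma 2.10 p. 382.
-/

noncomputable section

namespace Literature.NumberTheory.Kottwitz1992.Involutions

universe u

variable (B : Type u) [Ring B] [Algebra ℝ B] (ι : B →ₗ[ℝ] B) (τ : B →ₗ[ℝ] B)

variable {B ι} in
/-- `b* (b⁻¹)* = (b⁻¹ b)* = 1* = 1`, in the cancelling form `b* ((b⁻¹)* a) = a`. [cite: Kottwitz1992, §1 (p. 378)] -/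
private theorem invol_units_mul_inv_cancel_left (hι : IsInvolution ℝ B ι) (b : Bˣ) (a : B) :
    ι (b : B) * (ι ((b⁻¹ : Bˣ) : B) * a) = a := by
  have h1 : ι 1 = (1 : B) := by
    have h : ι (ι 1 * 1) = ι 1 * ι (ι 1) := hι.map_mul (ι 1) 1
    rw [mul_one, hι.apply_apply, mul_one] at h
    exact h.symm
  rw [← mul_assoc, ← hι.map_mul, Units.inv_mul, h1, one_mul]

/-- **Lemma 2.11, PROVED**: ★ `Kottwitz1992_2_11_two_positive_involutions` holds — «Let `*`, `!` be two positive involutions on `B`.  Then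
there exists `b ∈ B^×` such that `Int(b)` is a `*`-homomorphism from `(B, !)` to `(B, *)`.  Moreover we have `x^! = c⁻¹ x* c` for the element
`c = b* b`.»  As printed: Lemma 2.10 (first statement) applied to the identity map `(B, !) → (B, *)` gives `b` with `b x^! b⁻¹ = (b x b⁻¹)*`;
the second statement follows by expanding `(b x b⁻¹)* = (b⁻¹)* x* b*`. [cite: Kottwitz1992, Lemma 2.11 (p. 382)] -/
theorem Kottwitz1992_2_11_two_positive_involutions_holds : Kottwitz1992_2_11_two_positive_involutions B ι τ := by
  intro hB hpos hposτ
  have hι : IsInvolution ℝ B ι := hB.isInvolution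
  -- the standing hypothesis for `(B, !)`
  have hBτ : IsAlgebraWithInvolution B τ := ⟨hB.finiteDimensional, hB.isSemisimpleRing, hposτ.toIsInvolution⟩
  -- «Apply Lemma 2.10 to the identity map from `B` to `B`»
  obtain ⟨c, j, hj, hjc⟩ := (Kottwitz1992_2_10_starHom_conjugacy_holds B τ B ι hBτ hposτ hB hpos).1 (AlgHom.id ℝ B)
  have hjc' : ∀ b : B, j b = (c : B) * b * ↑c⁻¹ := fun b => by rw [hjc, AlgHom.id_apply]
  have h1 : ∀ x : B, (c : B) * τ x * ↑c⁻¹ = ι ((c : B) * x * ↑c⁻¹) := fun x => by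
    rw [← hjc', ← hjc']
    exact hj x
  refine ⟨c, h1, fun x => ?_⟩
  -- «The second statement follows from the first.»
  have h : ι (c : B) * ((c : B) * τ x * ↑c⁻¹) * (c : B) = ι (c : B) * ι ((c : B) * x * ↑c⁻¹) * (c : B) := by rw [h1 x]
  rw [hι.map_mul, hι.map_mul] at h
  simpa only [mul_assoc, Units.inv_mul, mul_one, invol_units_mul_inv_cancel_left hι] using h

end Literature.NumberTheory.Kottwitz1992.Involutions

end
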